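import Literature.Analysis.Complex.GeneralDirichletSeriesUniqueness
import Mathlib.Analysis.Complex.CauchyIntegral
import Mathlib.Analysis.Complex.LocallyUniformLimit
import Mathlib.Analysis.Complex.Convex
import Mathlib.Analysis.Analytic.Uniqueness
import Mathlib.Analysis.Analytic.IsolatedZeros
import Mathlib.Analysis.Normed.Group.Tannery
import HarnessLib

/-!
# Uniqueness for general Dirichlet series with repeated, locally finite exponents

Topic `Literature/Analysis/Complex`, continuing `GeneralDirichletSeriesUniqueness`
(`eq_zero_of_generalDirichlet_hasSum_zero`: separated increasing exponents, bounded coefficients).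
For lattice sums one needs the version where the exponents come from a countable index set with
finite fibres and only LOCAL finiteness (`{i | y i ≤ Y}` finite for every `Y`), and where the
conclusion is fibrewise; and one needs to pass from vanishing on a real INTERVAL to vanishing for
all large `s` (identity theorem for the holomorphic sum on `Re s > s₀`).

* `generalDirichlet_hasSum_zero_of_eqOn_Ioo` — nonnegative exponents, `∑ ‖cᵢ‖ e^{-s₀ yᵢ} < ∞`:
  if `∑ᵢ cᵢ e^{-yᵢ s} = 0` on a real interval `(a, b)` with `s₀ < a < b`, then it is `0` for every
  real `s > s₀`;
* **`fibre_sum_eq_zero_of_generalDirichlet_hasSum_zero`** — if `∑ᵢ cᵢ e^{-yᵢ s} = 0` for all real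
  `s > s₁`, then for every height `η` the finite fibre sum `∑_{i : yᵢ = η} cᵢ` vanishes (the least
  height with non-zero fibre sum would dominate as `s → ∞`).

Everything here is PROVED (no named facts, no definitions). This is the uniqueness theorem for
general Dirichlet series (Hardy–Riesz, *The General Theory of Dirichlet's Series* (1915), Thm 6) in
the absolutely convergent case, arranged for exponent sets with multiplicities: only real
`s → +∞` and dominated convergence for sums (Tannery) are used for the fibre statement, and the
identity theorem on the half-plane `Re s > s₀` for the interval statement.

[folklore]
-/

noncomputable section

namespace Literature.Analysis.Complex

open Filter Set
open scoped Topology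

/-- **From an interval to a half-line.** Let `ι` be countable, `y : ι → ℝ` nonnegative,
`c : ι → ℂ` with `∑ᵢ ‖cᵢ‖ e^{-s₀ yᵢ} < ∞`. If `∑ᵢ cᵢ e^{-yᵢ s} = 0` for all real `s` in an interval
`(a, b)`, `s₀ < a < b`, then `∑ᵢ cᵢ e^{-yᵢ s} = 0` for every real `s > s₀` (the sum is holomorphic
on `Re s > s₀` by locally uniform absolute convergence; identity theorem).
[folklore] -/
theorem generalDirichlet_hasSum_zero_of_eqOn_Ioo {ι : Type*} [Countable ι]
    {y : ι → ℝ} (hy : ∀ i, 0 ≤ y i) {c : ι → ℂ} {s₀ : ℝ}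
    (hsum : Summable fun i => ‖c i‖ * Real.exp (-(s₀ * y i)))
    {a b : ℝ} (ha : s₀ < a) (hab : a < b)
    (hzero : ∀ s : ℝ, s ∈ Set.Ioo a b → HasSum (fun i => c i * Complex.exp (-((y i : ℂ) * s))) 0) :
    ∀ s : ℝ, s₀ < s → HasSum (fun i => c i * Complex.exp (-((y i : ℂ) * s))) 0 := by
  -- the half-plane `U = {Re z > s₀}` and the termwise bound there
  set U : Set ℂ := {z : ℂ | s₀ < z.re}
  have hUo : IsOpen U := isOpen_lt continuous_const Complex.continuous_re
  have hle : ∀ (i : ι) (z : ℂ), z ∈ U →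
      ‖c i * Complex.exp (-((y i : ℂ) * z))‖ ≤ ‖c i‖ * Real.exp (-(s₀ * y i)) := by
    intro i z hz
    have hz' : s₀ < z.re := hz
    rw [norm_mul, Complex.norm_exp]
    refine mul_le_mul_of_nonneg_left (Real.exp_le_exp.2 ?_) (norm_nonneg _)
    have hre : (-((y i : ℂ) * z)).re = -(y i * z.re) := by simp
    rw [hre]
    have := mul_le_mul_of_nonneg_left hz'.le (hy i)
    linarith
  -- the sum function is holomorphic on `U`
  set D : ℂ → ℂ := fun z => ∑' i, c i * Complex.exp (-((y i : ℂ) * z)) with hD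
  have hDd : DifferentiableOn ℂ D U := by
    refine Complex.differentiableOn_tsum_of_summable_norm hsum (fun i => ?_) hUo hle
    exact (by fun_prop :
      Differentiable ℂ fun z : ℂ => c i * Complex.exp (-((y i : ℂ) * z))).differentiableOn
  have hDa : AnalyticOnNhd ℂ D U := hDd.analyticOnNhd hUo
  -- it vanishes at the real points of `(a, b)`, which accumulate at an interior point `m`
  have hreal : ∀ s : ℝ, s ∈ Set.Ioo a b → D s = 0 := fun s hs => (hzero s hs).tsum_eq
  obtain ⟨m, ham, hmb⟩ : ∃ m : ℝ, a < m ∧ m < b := ⟨(a + b) / 2, by linarith, by linarith⟩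
  have hmU : (m : ℂ) ∈ U := by
    show s₀ < (m : ℂ).re
    rw [Complex.ofReal_re]
    linarith
  have hfreq : ∃ᶠ z in 𝓝[≠] (m : ℂ), D z = 0 := by
    have htend : Tendsto (fun t : ℝ => (t : ℂ)) (𝓝[≠] m) (𝓝[≠] (m : ℂ)) :=
      Complex.continuous_ofReal.continuousWithinAt.tendsto_nhdsWithin fun t ht => by
        simpa using ht
    have hev : ∀ᶠ t : ℝ in 𝓝[≠] m, D (t : ℂ) = 0 := by
      have : ∀ᶠ t : ℝ in 𝓝 m, t ∈ Set.Ioo a b := Ioo_mem_nhds ham hmb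
      exact (this.filter_mono nhdsWithin_le_nhds).mono fun t ht => hreal t ht
    exact htend.frequently hev.frequently
  have hD0 := hDa.eqOn_zero_of_preconnected_of_frequently_eq_zero
    (convex_halfSpace_re_gt s₀).isPreconnected hmU hfreq
  -- conclusion at a real point `s > s₀`
  intro s hs
  have hsU : (s : ℂ) ∈ U := by
    show s₀ < (s : ℂ).re
    rwa [Complex.ofReal_re]
  have hsm : Summable fun i => c i * Complex.exp (-((y i : ℂ) * s)) :=
    .of_norm_bounded hsum fun i => hle i s hsU
  have h0 : ∑' i, c i * Complex.exp (-((y i : ℂ) * s)) = 0 := by simpa [hD] using hD0 hsU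
  have h := hsm.hasSum
  rwa [h0] at h

/-- The inductive step behind `fibre_sum_eq_zero_of_generalDirichlet_hasSum_zero`: if every fibre
sum at a height `y j < η` vanishes, so does the fibre sum at height `η`. Multiply the series by
`e^{η s}`: the finitely many terms of height `≤ η` group into fibres and contribute exactly the
fibre sum at `η`, while the terms of height `> η` tend to `0` as `s → +∞` by dominated convergence
(they decrease in `s`, and at `s = s₀` they are summable). [folklore] -/
private theorem fibre_sum_eq_zero_step {ι : Type*} {y : ι → ℝ}
    (hfin : ∀ Y : ℝ, {i : ι | y i ≤ Y}.Finite) {c : ι → ℂ} {s₀ s₁ : ℝ} (hs : s₀ ≤ s₁)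
    (hsum : Summable fun i => ‖c i‖ * Real.exp (-(s₀ * y i)))
    (hzero : ∀ s : ℝ, s₁ < s → HasSum (fun i => c i * Complex.exp (-((y i : ℂ) * s))) 0)
    {η : ℝ} (ih : ∀ j, y j < η → ∑ i ∈ (hfin (y j)).toFinset with y i = y j, c i = 0) :
    ∑ i ∈ (hfin η).toFinset with y i = η, c i = 0 := by
  set K : Finset ι := (hfin η).toFinset with hK
  have hmemK : ∀ i, i ∈ K ↔ y i ≤ η := fun i => by
    rw [hK, Set.Finite.mem_toFinset]
    rfl
  set A : ℂ := ∑ i ∈ K with y i = η, c i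
  -- the shifted terms `g s i = c i * e^{-(y i - η) s}` (a real exponential, cast to `ℂ`)
  set g : ℝ → ι → ℂ := fun s i => c i * (Real.exp (-((y i - η) * s)) : ℂ) with hg
  have hnorm : ∀ s i, ‖g s i‖ = ‖c i‖ * Real.exp (-((y i - η) * s)) := fun s i => by
    simp only [hg, norm_mul, Complex.norm_real, Real.norm_eq_abs, Real.abs_exp]
  -- (1) `∑ᵢ g s i = 0` for `s > s₁`
  have hg0 : ∀ s : ℝ, s₁ < s → HasSum (g s) 0 := by
    intro s hs1
    have h := (hzero s hs1).mul_left (Complex.exp (η * s))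
    rw [mul_zero] at h
    have hfun : (fun i => Complex.exp (η * s) * (c i * Complex.exp (-((y i : ℂ) * s)))) = g s := by
      funext i
      simp only [hg, Complex.ofReal_exp, Complex.ofReal_neg, Complex.ofReal_mul,
        Complex.ofReal_sub]
      rw [mul_left_comm, ← Complex.exp_add]
      congr 2
      ring
    rwa [hfun] at h
  -- (2) the finite part: `∑_{i ∈ K} g s i = A` (lower fibres vanish by `ih`)
  have hfinite : ∀ s : ℝ, ∑ i ∈ K, g s i = A := by
    intro s
    rw [← Finset.sum_filter_add_sum_filter_not K (fun i => y i = η)]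
    have h1 : ∑ i ∈ K with y i = η, g s i = A := by
      refine Finset.sum_congr rfl fun i hi => ?_
      have hiη : y i = η := (Finset.mem_filter.mp hi).2
      simp [hg, hiη]
    have h2 : ∑ i ∈ K with ¬ y i = η, g s i = 0 := by
      rw [← Finset.sum_fiberwise_of_maps_to (s := K.filter fun i => ¬ y i = η)
        (t := (K.filter fun i => ¬ y i = η).image y) (g := y)
        (fun i hi => Finset.mem_image_of_mem y hi) (g s)]
      refine Finset.sum_eq_zero fun θ hθ => ?_
      obtain ⟨j, hj, rfl⟩ := Finset.mem_image.mp hθ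
      have hjK : y j ≤ η ∧ ¬ y j = η := by simpa [hmemK] using hj
      have hjlt : y j < η := lt_of_le_of_ne hjK.1 hjK.2
      have hfib : (K.filter fun i => ¬ y i = η).filter (fun i => y i = y j)
          = (hfin (y j)).toFinset.filter (fun i => y i = y j) := by
        ext i
        simp only [Finset.mem_filter, hmemK, Set.Finite.mem_toFinset, Set.mem_setOf_eq]
        constructor
        · rintro ⟨-, h⟩
          exact ⟨h.le, h⟩
        · rintro ⟨-, h⟩
          exact ⟨⟨by rw [h]; exact hjlt.le, by rw [h]; exact hjlt.ne⟩, h⟩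
      calc ∑ i ∈ (K.filter fun i => ¬ y i = η) with y i = y j, g s i
          = ∑ i ∈ (K.filter fun i => ¬ y i = η) with y i = y j,
              c i * (Real.exp (-((y j - η) * s)) : ℂ) :=
            Finset.sum_congr rfl fun i hi => by rw [← (Finset.mem_filter.mp hi).2]
        _ = (∑ i ∈ (K.filter fun i => ¬ y i = η) with y i = y j, c i)
              * (Real.exp (-((y j - η) * s)) : ℂ) := by rw [Finset.sum_mul]
        _ = 0 := by rw [hfib, ih j hjlt, zero_mul]
    rw [h1, h2, add_zero]
  -- (3) hence the tail over `Kᶜ` equals `-A` for `s > s₁`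
  have htail : ∀ s : ℝ, s₁ < s → ∑' x : {x // x ∉ K}, g s x = -A := by
    intro s hs1
    have h := K.hasSum_iff_compl.mp (hg0 s hs1)
    rw [hfinite s, zero_sub] at h
    exact h.tsum_eq
  -- (4) the tail tends to `0` as `s → +∞` (dominated convergence)
  have hgt : ∀ x : {x // x ∉ K}, η < y x := fun x => not_le.mp fun h => x.2 ((hmemK x).mpr h)
  have hlim : Tendsto (fun s : ℝ => ∑' x : {x // x ∉ K}, g s x) atTop (𝓝 0) := by
    have hbound : Summable fun x : {x // x ∉ K} =>
        ‖c x‖ * Real.exp (-(s₀ * y x)) * Real.exp (η * s₀) :=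
      (hsum.mul_right (Real.exp (η * s₀))).comp_injective Subtype.val_injective
    have hpt : ∀ x : {x // x ∉ K}, Tendsto (fun s : ℝ => g s x) atTop (𝓝 0) := by
      intro x
      have h1 : Tendsto (fun s : ℝ => -((y x - η) * s)) atTop atBot :=
        tendsto_neg_atTop_atBot.comp (tendsto_id.const_mul_atTop (sub_pos.mpr (hgt x)))
      rw [tendsto_zero_iff_norm_tendsto_zero]
      simp only [hnorm]
      simpa using (Real.tendsto_exp_atBot.comp h1).const_mul ‖c (x : ι)‖
    have hdom : ∀ᶠ s : ℝ in atTop, ∀ x : {x // x ∉ K},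
        ‖g s x‖ ≤ ‖c x‖ * Real.exp (-(s₀ * y x)) * Real.exp (η * s₀) := by
      filter_upwards [eventually_gt_atTop s₁] with s hs1 x
      have hs0 : s₀ ≤ s := hs.trans hs1.le
      rw [hnorm, mul_assoc, ← Real.exp_add]
      refine mul_le_mul_of_nonneg_left (Real.exp_le_exp.2 ?_) (norm_nonneg _)
      have := mul_le_mul_of_nonneg_left hs0 (sub_pos.mpr (hgt x)).le
      linarith
    have := tendsto_tsum_of_dominated_convergence hbound hpt hdom
    simpa using this
  -- (5) a constant tending to `0` is `0`
  have hconst : Tendsto (fun _ : ℝ => -A) atTop (𝓝 (0 : ℂ)) := by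
    refine hlim.congr' ?_
    filter_upwards [eventually_gt_atTop s₁] with s hs1
    exact htail s hs1
  have hA0 : (0 : ℂ) = -A := tendsto_nhds_unique hconst tendsto_const_nhds
  exact neg_eq_zero.mp hA0.symm

/-- **Fibrewise uniqueness of general Dirichlet series with locally finite exponents.** Let `ι` be
countable, `y : ι → ℝ` with `{i | y i ≤ Y}` finite for every `Y`, `c : ι → ℂ` with
`∑ᵢ ‖cᵢ‖ e^{-s₀ yᵢ} < ∞`, and suppose `∑ᵢ cᵢ e^{-yᵢ s} = 0` for every real `s > s₁` (`s₁ ≥ s₀`).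
Then `∑_{i ∈ {i | y i = η}} cᵢ = 0` for every `η`. (Hardy–Riesz uniqueness, fibrewise form: the
least height with a non-zero fibre sum — it exists by local finiteness — would dominate the series
as `s → +∞`.) [folklore] -/
theorem fibre_sum_eq_zero_of_generalDirichlet_hasSum_zero {ι : Type*} [Countable ι]
    {y : ι → ℝ} (hfin : ∀ Y : ℝ, {i : ι | y i ≤ Y}.Finite) {c : ι → ℂ} {s₀ s₁ : ℝ} (hs : s₀ ≤ s₁)
    (hsum : Summable fun i => ‖c i‖ * Real.exp (-(s₀ * y i)))
    (hzero : ∀ s : ℝ, s₁ < s → HasSum (fun i => c i * Complex.exp (-((y i : ℂ) * s))) 0)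
    (η : ℝ) : ∑ i ∈ (hfin η).toFinset with y i = η, c i = 0 := by
  -- the fibre sums and the inductive step
  set A : ℝ → ℂ := fun θ => ∑ i ∈ (hfin θ).toFinset with y i = θ, c i with hA
  have step : ∀ θ : ℝ, (∀ j, y j < θ → A (y j) = 0) → A θ = 0 := fun θ ih =>
    fibre_sum_eq_zero_step hfin hs hsum hzero ih
  show A η = 0
  by_contra hne
  -- a witness `i₀` in the fibre of `η`, and a height-minimal `i₁` below `η` with non-zero fibre sum
  obtain ⟨i₀, hi₀⟩ := Finset.nonempty_of_sum_ne_zero hne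
  have hi₀K : i₀ ∈ (hfin η).toFinset := (Finset.mem_filter.mp hi₀).1
  have hyi₀ : y i₀ = η := (Finset.mem_filter.mp hi₀).2
  obtain ⟨i₁, hi₁, hmin⟩ :=
    ((hfin η).toFinset.filter fun i => A (y i) ≠ 0).exists_min_image y
      ⟨i₀, Finset.mem_filter.mpr ⟨hi₀K, by rw [hyi₀]; exact hne⟩⟩
  refine (Finset.mem_filter.mp hi₁).2 (step (y i₁) fun j hj => ?_)
  by_contra hAj
  have hi₁η : y i₁ ≤ η := by simpa using (Finset.mem_filter.mp hi₁).1
  have hjη : y j ≤ η := hj.le.trans hi₁η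
  have hle := hmin j (Finset.mem_filter.mpr ⟨(hfin η).mem_toFinset.mpr hjη, hAj⟩)
  exact absurd hj (not_lt.mpr hle)

end Literature.Analysis.Complex
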